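import Summits.CriticalPhenomena.Ising3DConformalLimit.Theorems.EnergyNotSigmaSquaredGapForcesFarMergingSandwichOnePinchDecayAuxDictionary
import Summits.CriticalPhenomena.Ising3DConformalLimit.Theorems.EnergyNotSigmaSquaredGapForcesFarMergingSandwichOnePinchDecayAuxGap
import Literature.Probability.LatticeModels.SourcedDoubleCurrentsSwitchingProofs
import HarnessLib

/-!
# S2 of the line `one-cluster-depletion-sandwich`: GAP ⟹ one-pinch duplicated avoidance decays
(crux `GapForcesFarMerging`, item stmt-CriticalPhenomena-4468, route `EnergyNotSigmaSquared`;
registered stub `stub_onePinchDecay : DoubleSandwich → EnergyGapPowerLaw → OnePinchDecay`, lead seat c1)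

Assembly of the two auxiliary files:
* `…OnePinchDecayAuxGap` (`onePinchDecay_one_sub_probInf_le`): GAP, the landed RP Gram minor
  `rpUnpinchShape_criticalCorr`, the Lebowitz/Griffiths/MMS envelope and Aizenman's energy factorisation
  give, inside every doubling window `Doubling θ K` (`K ≥ 1`), the INFINITE-VOLUME bound
  `1 - P^{0p_K, e₂q_K}_{β_c}[0 ↔ e₂] ≤ D (2^K)^{-κ/2}`;
* doubling windows occur at infinitely many octaves for `θ₀ = 4^{-15}` (`frequently_doubling_window`,
  proved here: pigeonhole on `c‖x‖⁻² ≤ G ≤ 1` with MMS along the first axis);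
* `…OnePinchDecayAuxDictionary` (`onePinchDecay_avoid_le_one_sub_merge`): the hypothesis
  `DoubleSandwich`, normalised in the free box `Λ_n`, reads `avoid n y ≤ 1 - merge n y`;
* box passage `P^{0p,e₂q}_{Λ_n}[0 ↔ e₂] → P^{0p,e₂q}_{β_c}[0 ↔ e₂]`
  (`tendsto_sourcedDoubleCurrentLaw_real_openConn`), with slack `(2^K)^{-κ/2}`.
Hence `OnePinchDecay` with `κ' = κ/2`, `C' = D + 1`, `θ = θ₀`.

References: Aizenman–Duminil-Copin 2021 (arXiv:1912.07973), eqs. (3.11), (3.13), (5.3), §3.2 footnote 5,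
App. A Lemma A.1 [AizenmanDuminilCopinAnnals2021]; Fröhlich–Israel–Lieb–Simon 1978, Thm 2.1 [FILS1978];
Messager–Miracle-Solé 1977 [MessagerMiracleSoleJSP1977].
-/

noncomputable section

namespace Summit.CriticalPhenomena.Ising3DConformalLimit.EnergyNotSigmaSquaredGapForcesFarMergingSandwich

namespace OnePinchDecayProof

open scoped symmDiff
open MeasureTheory Filter
open Literature.Probability.LatticeModels Literature.Probability.Percolation
open Summit.CriticalPhenomena.Ising3DConformalLimit.GapForcesFarMergingSandwich
open Summit.CriticalPhenomena.Ising3DConformalLimit.Theses.EnergyNotSigmaSquared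
open Summit.CriticalPhenomena.Ising3DConformalLimit.Theorems.GapForcesFarMerging.Negative
  (softPackageNoBubble_criticalCorr)

/-! ## Doubling windows occur at infinitely many octaves -/

/-- `(2^n)^{-2} = 4^{-n}`. [folklore] -/
theorem two_pow_rpow_neg_two (n : ℕ) : ((2 : ℝ) ^ n) ^ (-(2 : ℝ)) = (1 / 4 : ℝ) ^ n := by
  rw [Real.rpow_neg (by positivity), Real.rpow_two, ← pow_mul, mul_comm, pow_mul, one_div, inv_pow]
  norm_num

/-- **Doubling windows are unbounded.** For `θ₀ = 4^{-15}`, infinitely many octaves `K` carry a window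
`Doubling θ₀ K`: otherwise every block of seven consecutive octaves beyond some `a` contains a drop
`G(2^{j+1}e₁) < θ₀ G(2^j e₁)`; chaining the drops of every other block with MMS
(`G(2^{m'}e₁) ≤ G(2^m e₁)`, `m' ≥ m+2`) gives `G(2^{j_k}e₁) ≤ θ₀^k` along octaves `j_k ≤ a + 14k + 6`,
against the lower bound `G(x) ≥ c‖x‖⁻²` of the critical two-point function of `ℤ³`. [folklore] -/
theorem frequently_doubling_window : ∃ᶠ K : ℕ in atTop, Doubling ((1 / 4 : ℝ) ^ 15) K := by
  obtain ⟨c, hc, hlow⟩ := softPackageNoBubble_criticalCorr.lower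
  rw [Filter.frequently_atTop]
  intro a
  by_contra hcon
  push Not at hcon
  have hbad : ∀ K : ℕ, a ≤ K → ∃ j : ℕ, K ≤ j + 3 ∧ j ≤ K + 3 ∧
      G (((2 : ℤ) ^ (j + 1)) • e₁) < (1 / 4 : ℝ) ^ 15 * G (((2 : ℤ) ^ j) • e₁) := by
    intro K hK
    have h := hcon K hK
    unfold Doubling at h
    push Not at h
    exact h
  choose! j hj using hbad
  -- the subsequence of drops in every other block: `s k = j (a + 3 + 14 k)`
  have hs : ∀ k : ℕ, a + 14 * k ≤ j (a + 3 + 14 * k) ∧ j (a + 3 + 14 * k) ≤ a + 14 * k + 6 ∧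
      G (((2 : ℤ) ^ (j (a + 3 + 14 * k) + 1)) • e₁) <
        (1 / 4 : ℝ) ^ 15 * G (((2 : ℤ) ^ (j (a + 3 + 14 * k))) • e₁) := by
    intro k
    obtain ⟨h1, h2, h3⟩ := hj (a + 3 + 14 * k) (by omega)
    exact ⟨by omega, by omega, h3⟩
  -- geometric decay along the subsequence
  have hdec : ∀ k : ℕ, G (((2 : ℤ) ^ (j (a + 3 + 14 * k))) • e₁) ≤ ((1 / 4 : ℝ) ^ 15) ^ k := by
    intro k
    induction k with
    | zero => simpa using G_le_one _
    | succ k ih =>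
      obtain ⟨-, hk2, hk3⟩ := hs k
      obtain ⟨hk1', -, -⟩ := hs (k + 1)
      have hmms : G (((2 : ℤ) ^ (j (a + 3 + 14 * (k + 1)))) • e₁) ≤
          G (((2 : ℤ) ^ (j (a + 3 + 14 * k) + 1)) • e₁) :=
        G_dyadic_le (by omega)
      calc G (((2 : ℤ) ^ (j (a + 3 + 14 * (k + 1)))) • e₁)
          ≤ (1 / 4 : ℝ) ^ 15 * G (((2 : ℤ) ^ (j (a + 3 + 14 * k))) • e₁) := hmms.trans hk3.le
        _ ≤ (1 / 4 : ℝ) ^ 15 * ((1 / 4 : ℝ) ^ 15) ^ k := by gcongr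
        _ = ((1 / 4 : ℝ) ^ 15) ^ (k + 1) := by ring
  -- the polynomial lower bound along the subsequence
  have hlow' : ∀ k : ℕ, c * (1 / 4 : ℝ) ^ (a + 6) * ((1 / 4 : ℝ) ^ 14) ^ k ≤
      G (((2 : ℤ) ^ (j (a + 3 + 14 * k))) • e₁) := by
    intro k
    obtain ⟨-, hk2, -⟩ := hs k
    have h := hlow _ (two_pow_smul_e₁_ne_zero (j (a + 3 + 14 * k)))
    rw [norm_two_pow_smul_e₁, two_pow_rpow_neg_two, ← softPackageNoBubble_criticalCorr.two] at h
    refine le_trans ?_ h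
    rw [mul_assoc]
    refine mul_le_mul_of_nonneg_left ?_ hc.le
    calc (1 / 4 : ℝ) ^ (a + 6) * ((1 / 4 : ℝ) ^ 14) ^ k = (1 / 4 : ℝ) ^ (a + 14 * k + 6) := by
          rw [← pow_mul, ← pow_add]; congr 1; ring
      _ ≤ (1 / 4 : ℝ) ^ (j (a + 3 + 14 * k)) :=
          pow_le_pow_of_le_one (by norm_num) (by norm_num) hk2
  -- comparison: `c 4^{-(a+6)} ≤ 4^{-k}` for all `k`, absurd
  have hkey : ∀ k : ℕ, c * (1 / 4 : ℝ) ^ (a + 6) ≤ (1 / 4 : ℝ) ^ k := by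
    intro k
    have ht : (0 : ℝ) < ((1 / 4 : ℝ) ^ 14) ^ k := by positivity
    have h := (hlow' k).trans (hdec k)
    rw [show ((1 / 4 : ℝ) ^ 15) ^ k = (1 / 4 : ℝ) ^ k * ((1 / 4 : ℝ) ^ 14) ^ k by
      rw [← mul_pow]; congr 1; ring] at h
    exact le_of_mul_le_mul_right h ht
  have hA : (0 : ℝ) < c * (1 / 4 : ℝ) ^ (a + 6) := by positivity
  obtain ⟨k, hk⟩ := exists_pow_lt_of_lt_one hA (by norm_num : (1 : ℝ) / 4 < 1)
  exact absurd (hkey k) (not_le.2 hk)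

/-! ## Box passage and assembly -/

/-- Eventually in the box size, the four points of the one-pinch quadruple lie in `Λ_n`. [folklore] -/
theorem eventually_pinch_mem_box (K : ℕ) : ∀ᶠ n : ℕ in atTop, ∀ i, pinch K i ∈ box 3 n := by
  obtain ⟨L₀, hL₀⟩ := exists_forall_subset_box 3 (Finset.univ.image (pinch K))
  filter_upwards [eventually_ge_atTop L₀] with n hn
  intro i
  exact hL₀ n hn (Finset.mem_image_of_mem _ (Finset.mem_univ i))

/-- The two-current merging probability of the one-pinch quadruple is the box law's mass of the
connection event `{0 ↔ e₂}` (definitional unfolding). [folklore] -/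
theorem merge_pinch (n K : ℕ) :
    merge n (pinch K) =
      (sourcedDoubleCurrentLaw 3 n (criticalBeta 3) ({0} ∆ {pFar K}) ({e₂} ∆ {qFar K})).real
        (openConn 0 e₂) := rfl

/-- **One octave of the decay.** If `DoubleSandwich` holds and the infinite-volume avoidance of the
one-pinch pair at octave `K` is `≤ B`, then eventually in the box size
`avoid n (pinch K) ≤ B + (2^K)^{-κ}` (dictionary + box passage with slack `(2^K)^{-κ}`).
[cite: AizenmanDuminilCopinAnnals2021, §3.2 footnote 5 and App. A Lemma A.1] -/
theorem eventually_avoid_pinch_le (hDS : DoubleSandwich) {κ B : ℝ} (K : ℕ)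
    (hB : 1 - (sourcedDoubleCurrentLawInf 3 (criticalBeta 3) ({0} ∆ {pFar K}) ({e₂} ∆ {qFar K})).real
        (openConn 0 e₂) ≤ B) :
    ∀ᶠ n : ℕ in atTop, avoid n (pinch K) ≤ B + ((2 : ℝ) ^ K) ^ (-κ) := by
  have hβ : 0 < criticalBeta 3 := criticalBeta_pos_holds (d := 3) (by norm_num)
  have hs : 0 < ((2 : ℝ) ^ K) ^ (-κ) := Real.rpow_pos_of_pos (by positivity) _
  have hlim := tendsto_sourcedDoubleCurrentLaw_real_openConn (d := 3) (by norm_num) hβ le_rfl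
    0 (pFar K) e₂ (qFar K)
  have hev : ∀ᶠ n : ℕ in atTop,
      (sourcedDoubleCurrentLawInf 3 (criticalBeta 3) ({0} ∆ {pFar K}) ({e₂} ∆ {qFar K})).real
          (openConn 0 e₂) - ((2 : ℝ) ^ K) ^ (-κ) <
        (sourcedDoubleCurrentLaw 3 n (criticalBeta 3) ({0} ∆ {pFar K}) ({e₂} ∆ {qFar K})).real
          (openConn 0 e₂) :=
    hlim.eventually_const_lt (by linarith)
  filter_upwards [hev, eventually_pinch_mem_box K] with n hn hbox
  have hdict := onePinchDecay_avoid_le_one_sub_merge hDS n (pinch K) hbox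
  rw [merge_pinch] at hdict
  linarith

end OnePinchDecayProof

open scoped symmDiff
open MeasureTheory Filter
open Literature.Probability.LatticeModels Literature.Probability.Percolation
open Summit.CriticalPhenomena.Ising3DConformalLimit.GapForcesFarMergingSandwich
open Summit.CriticalPhenomena.Ising3DConformalLimit.Theses.EnergyNotSigmaSquared

/-- **S2 — GAP ⟹ the one-pinch duplicated avoidance decays as a power along doubling octaves.**
`DoubleSandwich → EnergyGapPowerLaw → OnePinchDecay`, with `κ' = κ/2`, window constant
`θ₀ = 4^{-15}` and `C' = D(C, θ₀) + 1`: along the infinitely many doubling octaves `K`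
(`frequently_doubling_window`), eventually in the box size `n`,
`avoid n (pinch K) ≤ 1 - merge n (pinch K)` (the double sandwich, normalised:
`onePinchDecay_avoid_le_one_sub_merge`) `≤ 1 - P^{0p_K,e₂q_K}_{β_c}[0 ↔ e₂] + (2^K)^{-κ'}` (box passage)
`≤ (D + 1)(2^K)^{-κ'}` (RP un-pinching + GAP + Lebowitz/MMS envelope + energy factorisation inside the
window: `onePinchDecay_one_sub_probInf_le`). [cite: AizenmanDuminilCopinAnnals2021, eqs. (3.11), (3.13) and App. A Lemma A.1] [cite: FILS1978, Thm. 2.1] -/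
theorem stub_onePinchDecay : DoubleSandwich → EnergyGapPowerLaw → OnePinchDecay := by
  intro hDS hGAP
  have hθ : (0 : ℝ) < (1 / 4 : ℝ) ^ 15 := by positivity
  obtain ⟨κ, D, hκ, hb⟩ := onePinchDecay_one_sub_probInf_le hGAP ((1 / 4 : ℝ) ^ 15) hθ
  refine ⟨κ, D + 1, (1 / 4 : ℝ) ^ 15, hκ, hθ, ?_⟩
  refine (OnePinchDecayProof.frequently_doubling_window.and_eventually (eventually_ge_atTop 1)).mono ?_
  rintro K ⟨hD, hK⟩
  refine ⟨hD, ?_⟩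
  filter_upwards [OnePinchDecayProof.eventually_avoid_pinch_le hDS (κ := κ) K (hb K hK hD)] with n hn
  exact hn.trans (le_of_eq (by ring))

end Summit.CriticalPhenomena.Ising3DConformalLimit.EnergyNotSigmaSquaredGapForcesFarMergingSandwich

end
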